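import Literature.MathematicalPhysics.QuantumFieldTheory.Balaban1983to89.Beta.AveragingMixedJetTables

/-!
# `BalabanUV.Beta.D1BFx.WordRecordingAlgebra` — road «BF-x» for binder row D1, junction (J1), «SYMMIX-MASS» FILE 3 of 5: **THE WORD-RECORDING ALGEBRA** — the
# states `Idx S = • | (u) | (u,v) | (u,v,w)` over a finite alphabet, the prefix-incidence SUBALGEBRA `recAlg S ⊆ Matrix (Idx S) (Idx S) ℚ`, the CHAIN
# HOMOMORPHISMS `theta w : recAlg S →ₐ[ℚ] Matrix (Fin 4) (Fin 4) ℚ`, the recording letters `m01 ∕ m12 ∕ m23` with `θ_w (m01 f) = [f = w₁]·E 0 1` etc., and,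
# on the lattice (alphabet `S = bondSet d L`), the letter FORMS `recW ∕ rec12 ∕ rec23` with `θ_w ∘ recW = single w₁ (E 0 1)` etc.

HONEST DEPENDENCY (cell records, verbatim): «continuum YM on T⁴ ⇐ BetaPertH ∧ nine spine estimates (0/9 proved); BetaPertH ⇐ (D1) ∧ (D4) ∧
CAP+tail; G-an2-4 gates asym, D1 and NE2/3/4.»  HONEST FRAMING (cell contract, verbatim): «discharging `BetaPertH` makes Bałaban's UV stability
UNCONDITIONAL — a real constructive-QFT result; it is NOT the continuum limit and NOT the Clay problem.»  THIS MODULE DISCHARGES NOTHING of the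
wall: [folklore] finite bookkeeping over Mathlib's `Matrix ∕ Subalgebra ∕ AlgHom` and lit node 12b's `E ∕ single ∕ bondSet` BY NAME; DEFINITION lane (the
automaton's states, its algebra, its letters — OUR objects), 0 cite, 0 `def … : Prop`, 0 sorry.  It prices NO word and proves NO (1.22) row; 0 root-level
binders of row D1 discharged (hW ∕ hR-sockets ∕ hSX-socket ∕ D1Tel ∕ D1Rep = 0); (J1) ONE OPEN ROW; (K) NOT closed; NOT D1, NEVER «G-an2-4 closed», NOT `BetaPertH`,
NOT continuum, NOT Clay.

ABSOLUTE RULE (cell charter, verbatim): «No internally-minted statement may enter as a cited fact. Every hypothesis is either kernel-proved in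
this package or a verbatim quotation of a PUBLISHED theorem with page reference. The manuscript(s) under audit are NOT citable for their own
disputed steps — they are the thing under adjudication; programme-internal (2001/route/tribunal) claims are never citable.»

WHY.  an1 extracts the mixed table `a_sym(f,g,f′)` as the `(0,3)` entry of `symMjetAt` computed in node 12b's `4 × 4` path algebra with the letter `E 0 1` placed at
the ONE bond `f`, `E 1 2` at `f′`, `E 2 3` at `g` — one computation per triple.  The recording algebra runs ALL triples at once: its states remember which
bonds the word has used so far, the letters `m01 f = E_{•,(f)}`, `m12 f = Σ_u E_{(u),(u,f)}`, `m23 f = Σ_{u,v} E_{(u,v),(u,v,f)}` lie in the subalgebra of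
matrices supported on the prefix relation, and RESTRICTION TO THE CHAIN `• ≼ (u) ≼ (u,v) ≼ (u,v,w)` — a convex sub-poset — is an algebra homomorphism onto the
`4 × 4` algebra carrying the recording letters to an1's single-bond letters at `(u, v, w)`.  Naturality of the jet (FILE 4) then identifies every table entry
with an entry of ONE element, whose weighted operator norm (FILE 2) is controlled letter by letter (FILE 5).

CONTENT ([folklore] throughout; [our object] for the definitions).
* §1 `Idx`, `Idx.lv`, the prefix relation `Idx.pre` (`pre_self`, **`pre_trans`**), `Idx.chain w : Fin 4 → Idx S` (`chain_injective`, CONVEXITY **`eq_chain_of_pre`**).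
* §2 `Fintype (Idx S)`; **`recAlg S : Subalgebra ℚ (Matrix (Idx S) (Idx S) ℚ)`**; `mul_chain_apply`; **`theta w : recAlg S →ₐ[ℚ] Matrix (Fin 4) (Fin 4) ℚ`**, `theta_apply`.
* §3 `m01 ∕ m12 ∕ m23` (`∈ recAlg`), **`theta_m01 ∕ theta_m12 ∕ theta_m23`**.
* §4 `SB d L := ↥(bondSet d L)`; `recW ∕ rec12 ∕ rec23 : Form1 d (recAlg (SB d L))` (`0` off the box); **`theta_recW ∕ theta_rec12 ∕ theta_rec23`** (function-level).
NOT HERE: norms (FILES 2, 4), the jet (FILE 4), the letter (FILE 5).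
Unit `b2b-balaban-beta-d1-formalise-leaf-04` (gen 29), D1 formalisation swarm LEAF PROVER 04, road «BF-x» supplier; INTENT I-leaf04-g29-1 «SYMMIX-MASS»
(journal), taking the OWNER d1-p2 g25's located WANTED «the n-law of `symMixAbs`» (W-g25-9 (a)).  Not in print; our bookkeeping.  No existing file touched.
-/

noncomputable section

open Finset
open scoped BigOperators
open Literature.MathematicalPhysics.QuantumFieldTheory.Balaban1983to89.Beta
open Literature.MathematicalPhysics.QuantumFieldTheory.Balaban1983to89.Beta.AffineAveraging
open Literature.MathematicalPhysics.QuantumFieldTheory.Balaban1983to89.Beta.AveragingHessianKernels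
open Literature.MathematicalPhysics.QuantumFieldTheory.Balaban1983to89.Beta.AveragingMixedJetTables

namespace Summit.QuantumFields.BalabanUV.Beta.D1BFx.WordRecordingAlgebra

/-! ## §1 The index type of words of length `≤ 3` over an alphabet `S`, the prefix relation, the chains -/

/-- [our object] Words of length `≤ 3` over the alphabet `S` (the states of the word-recording automaton). -/
inductive Idx (S : Type*)
  | nil : Idx S
  | one : S → Idx S
  | two : S → S → Idx S
  | three : S → S → S → Idx S
deriving DecidableEq

/-- [our object] The empty word inhabits the states. -/
instance {S : Type*} : Inhabited (Idx S) := ⟨Idx.nil⟩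

namespace Idx

variable {S : Type*}

/-- [our object] The level (word length) of a state. -/
def lv : Idx S → ℕ
  | nil => 0
  | one _ => 1
  | two _ _ => 2
  | three _ _ _ => 3

/-- [our object] The PREFIX relation `j ≼ k` («`k` extends `j`»), as a `Bool`. -/
def pre [DecidableEq S] : Idx S → Idx S → Bool
  | nil, _ => true
  | one a, one a' => decide (a = a')
  | one a, two a' _ => decide (a = a')
  | one a, three a' _ _ => decide (a = a')
  | two a b, two a' b' => decide (a = a' ∧ b = b')
  | two a b, three a' b' _ => decide (a = a' ∧ b = b')
  | three a b c, three a' b' c' => decide (a = a' ∧ b = b' ∧ c = c')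
  | _, _ => false

variable [DecidableEq S]

/-- [folklore] The prefix relation is reflexive. -/
@[simp] theorem pre_self (j : Idx S) : pre j j = true := by
  cases j <;> simp [pre]

/-- [folklore] The prefix relation is transitive. -/
theorem pre_trans {j l k : Idx S} (h₁ : pre j l = true) (h₂ : pre l k = true) : pre j k = true := by
  cases j <;> cases l <;> cases k <;> simp_all [pre]

/-- [our object] The CHAIN of the word `w = (u, v, x)`: `• ≼ (u) ≼ (u,v) ≼ (u,v,x)`. -/
def chain (w : S × S × S) : Fin 4 → Idx S
  | 0 => nil
  | 1 => one w.1
  | 2 => two w.1 w.2.1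
  | 3 => three w.1 w.2.1 w.2.2

omit [DecidableEq S] in
/-- [folklore] The chain is injective. -/
theorem chain_injective (w : S × S × S) : Function.Injective (chain w) := by
  intro i j h
  fin_cases i <;> fin_cases j <;> simp_all [chain]

/-- [folklore] CONVEXITY of the chain: a prefix of a chain element is a chain element. -/
theorem eq_chain_of_pre {w : S × S × S} {l : Idx S} {i : Fin 4} (h : pre l (chain w i) = true) : ∃ m : Fin 4, l = chain w m := by
  obtain ⟨u, v, x⟩ := w
  fin_cases i <;> cases l <;> simp_all [pre, chain]
  · exact ⟨0, rfl⟩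
  · exact ⟨0, rfl⟩
  · exact ⟨1, rfl⟩
  · exact ⟨0, rfl⟩
  · exact ⟨1, rfl⟩
  · exact ⟨2, by simp⟩
  · exact ⟨0, rfl⟩
  · exact ⟨1, rfl⟩
  · exact ⟨2, by simp⟩
  · exact ⟨3, by simp⟩

end Idx

/-! ## §2 The word-recording subalgebra `A ⊆ Matrix (Idx S) (Idx S) ℚ` (prefix-order incidence matrices) -/

section Alg

variable (S : Type*) [Fintype S] [DecidableEq S]

open Idx

/-- [our object] The states over a finite alphabet are finite (`Idx S ≃ Unit ⊕ S ⊕ S² ⊕ S³`). -/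
instance : Fintype (Idx S) :=
  Fintype.ofEquiv (Unit ⊕ S ⊕ (S × S) ⊕ (S × S × S))
    { toFun := fun z => match z with
        | Sum.inl _ => Idx.nil
        | Sum.inr (Sum.inl a) => Idx.one a
        | Sum.inr (Sum.inr (Sum.inl ⟨a, b⟩)) => Idx.two a b
        | Sum.inr (Sum.inr (Sum.inr ⟨a, b, c⟩)) => Idx.three a b c
      invFun := fun j => match j with
        | Idx.nil => Sum.inl ()
        | Idx.one a => Sum.inr (Sum.inl a)
        | Idx.two a b => Sum.inr (Sum.inr (Sum.inl ⟨a, b⟩))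
        | Idx.three a b c => Sum.inr (Sum.inr (Sum.inr ⟨a, b, c⟩))
      left_inv := fun z => by rcases z with _ | a | ⟨a, b⟩ | ⟨a, b, c⟩ <;> rfl
      right_inv := fun j => by cases j <;> rfl }

/-- [our object] THE WORD-RECORDING ALGEBRA: matrices supported on the prefix relation. -/
def recAlg : Subalgebra ℚ (Matrix (Idx S) (Idx S) ℚ) where
  carrier := {M | ∀ j k, pre j k = false → M j k = 0}
  mul_mem' := by
    intro M N hM hN j k hjk
    rw [Matrix.mul_apply]
    refine Finset.sum_eq_zero fun l _ => ?_
    by_cases h₁ : pre j l = true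
    · by_cases h₂ : pre l k = true
      · exact absurd (pre_trans h₁ h₂) (by simp [hjk])
      · rw [hN l k (by simpa using h₂), mul_zero]
    · rw [hM j l (by simpa using h₁), zero_mul]
  one_mem' := by
    intro j k hjk
    have : j ≠ k := by rintro rfl; simp at hjk
    simp [this]
  add_mem' := by
    intro M N hM hN j k hjk
    simp [hM j k hjk, hN j k hjk]
  zero_mem' := by intro j k _; rfl
  algebraMap_mem' := by
    intro r j k hjk
    have : j ≠ k := by rintro rfl; simp at hjk
    simp [Matrix.algebraMap_matrix_apply, this]

variable {S}

/-- [folklore] Membership in the word-recording algebra. -/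
theorem mem_recAlg {M : Matrix (Idx S) (Idx S) ℚ} : M ∈ recAlg S ↔ ∀ j k, pre j k = false → M j k = 0 := Iff.rfl

/-- [folklore] Off the chain of `w`, an entry of a product of two recording matrices read on the chain gets no contribution. -/
theorem mul_chain_apply {M N : Matrix (Idx S) (Idx S) ℚ} (hM : M ∈ recAlg S) (hN : N ∈ recAlg S) (w : S × S × S) (i j : Fin 4) :
    (M * N) (chain w i) (chain w j) = ∑ m : Fin 4, M (chain w i) (chain w m) * N (chain w m) (chain w j) := by
  classical
  rw [Matrix.mul_apply]
  have hsub : (Finset.univ : Finset (Fin 4)).image (chain w) ⊆ Finset.univ := Finset.subset_univ _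
  rw [← Finset.sum_subset hsub, Finset.sum_image fun a _ b _ h => chain_injective w h]
  intro l _ hl
  by_cases h₂ : pre l (chain w j) = true
  · obtain ⟨m, rfl⟩ := eq_chain_of_pre h₂
    exact absurd (Finset.mem_image_of_mem _ (Finset.mem_univ m)) hl
  · have := hM  -- unused guard
    rw [hN l _ (by simpa using h₂), mul_zero]

/-- [our object] THE CHAIN HOMOMORPHISM `θ_w : A → Matrix (Fin 4) (Fin 4) ℚ`: restriction of a recording matrix to the convex chain of `w`. -/
def theta (w : S × S × S) : recAlg S →ₐ[ℚ] Matrix (Fin 4) (Fin 4) ℚ where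
  toFun M := Matrix.of fun i j => (M : Matrix (Idx S) (Idx S) ℚ) (chain w i) (chain w j)
  map_one' := by
    ext i j
    simp only [Matrix.of_apply, OneMemClass.coe_one, Matrix.one_apply, (chain_injective w).eq_iff]
  map_mul' M N := by
    ext i j
    simp only [Matrix.of_apply, MulMemClass.coe_mul, Matrix.mul_apply]
    exact mul_chain_apply M.2 N.2 w i j
  map_zero' := by ext i j; simp
  map_add' M N := by ext i j; simp
  commutes' r := by
    ext i j
    rw [Matrix.of_apply, Subalgebra.coe_algebraMap, Matrix.algebraMap_matrix_apply, Matrix.algebraMap_matrix_apply]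
    simp only [(chain_injective w).eq_iff]

/-- [folklore] The entries of `θ_w M`. -/
@[simp] theorem theta_apply (w : S × S × S) (M : recAlg S) (i j : Fin 4) :
    theta w M i j = (M : Matrix (Idx S) (Idx S) ℚ) (chain w i) (chain w j) := rfl

/-! ## §3 The recording letters at the three level transitions and their images under the chain homomorphisms -/

/-- [our object] The level `0 → 1` recording letter of `f`: `E_{•,(f)}`. -/
def m01 (f : S) : Matrix (Idx S) (Idx S) ℚ := Matrix.of fun j k => match j, k with
  | Idx.nil, Idx.one a => if a = f then 1 else 0
  | _, _ => 0

/-- [our object] The level `1 → 2` recording letter of `f`: `Σ_u E_{(u),(u,f)}`. -/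
def m12 (f : S) : Matrix (Idx S) (Idx S) ℚ := Matrix.of fun j k => match j, k with
  | Idx.one u, Idx.two u' a => if u = u' ∧ a = f then 1 else 0
  | _, _ => 0

/-- [our object] The level `2 → 3` recording letter of `f`: `Σ_{u,v} E_{(u,v),(u,v,f)}`. -/
def m23 (f : S) : Matrix (Idx S) (Idx S) ℚ := Matrix.of fun j k => match j, k with
  | Idx.two u v, Idx.three u' v' a => if u = u' ∧ v = v' ∧ a = f then 1 else 0
  | _, _ => 0

/-- [folklore] The recording letters are recording matrices. -/
theorem m01_mem (f : S) : m01 f ∈ recAlg S := by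
  intro j k hjk; cases j <;> cases k <;> simp_all [m01, pre]

/-- [folklore] -/
theorem m12_mem (f : S) : m12 f ∈ recAlg S := by
  intro j k hjk; cases j <;> cases k <;> simp_all [m12, pre]

/-- [folklore] -/
theorem m23_mem (f : S) : m23 f ∈ recAlg S := by
  intro j k hjk; cases j <;> cases k <;> simp_all [m23, pre]

/-- [folklore] `θ_w` of the `0 → 1` letter of `f` is `[f = w₁]·E₀₁`. -/
theorem theta_m01 (w : S × S × S) (f : S) :
    theta w ⟨m01 f, m01_mem f⟩ = if f = w.1 then E 0 1 else 0 := by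
  ext i j
  simp only [theta_apply]
  fin_cases i <;> fin_cases j <;> by_cases h : f = w.1 <;> simp [m01, chain, E, Matrix.single, h, eq_comm]

/-- [folklore] `θ_w` of the `1 → 2` letter of `f` is `[f = w₂]·E₁₂`. -/
theorem theta_m12 (w : S × S × S) (f : S) :
    theta w ⟨m12 f, m12_mem f⟩ = if f = w.2.1 then E 1 2 else 0 := by
  ext i j
  simp only [theta_apply]
  fin_cases i <;> fin_cases j <;> by_cases h : f = w.2.1 <;> simp [m12, chain, E, Matrix.single, h, eq_comm]

/-- [folklore] `θ_w` of the `2 → 3` letter of `f` is `[f = w₃]·E₂₃`. -/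
theorem theta_m23 (w : S × S × S) (f : S) :
    theta w ⟨m23 f, m23_mem f⟩ = if f = w.2.2 then E 2 3 else 0 := by
  ext i j
  simp only [theta_apply]
  fin_cases i <;> fin_cases j <;> by_cases h : f = w.2.2 <;> simp [m23, chain, E, Matrix.single, h, eq_comm]

end Alg

/-! ## §4 The recording letter forms on the lattice (alphabet `S = bondSet d L`) and their chain images -/

section Lattice

variable (d L : ℕ)

/-- [our object] THE ALPHABET: the bonds based in node 7a's support box of the block `0`. -/
abbrev SB : Type := ↥(bondSet d L)

/-- [our object] The `W`-recording letter form: `W♭_{(κ,x)} = m01 (κ,x)` on the support box, `0` off it. -/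
def recW : Form1 d (recAlg (SB d L)) := fun κ x =>
  if h : (κ, x) ∈ bondSet d L then ⟨m01 ⟨(κ, x), h⟩, m01_mem _⟩ else 0

/-- [our object] The level `1 → 2` recording letter form. -/
def rec12 : Form1 d (recAlg (SB d L)) := fun κ x =>
  if h : (κ, x) ∈ bondSet d L then ⟨m12 ⟨(κ, x), h⟩, m12_mem _⟩ else 0

/-- [our object] The level `2 → 3` recording letter form. -/
def rec23 : Form1 d (recAlg (SB d L)) := fun κ x =>
  if h : (κ, x) ∈ bondSet d L then ⟨m23 ⟨(κ, x), h⟩, m23_mem _⟩ else 0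

variable {d L}

/-- [folklore] **`θ_w ∘ W♭ = single w₁ (E 0 1)`**: the chain of `w` reads the `W`-recording form as an1's single-bond letter at `w₁`. -/
theorem theta_recW (w : SB d L × SB d L × SB d L) :
    (fun κ x => theta w (recW d L κ x)) = single (w.1 : Bond d) (E 0 1) := by
  funext κ x
  unfold recW
  split_ifs with h
  · rw [theta_m01]
    by_cases hw : (⟨(κ, x), h⟩ : SB d L) = w.1
    · have : (κ, x) = (w.1 : Bond d) := congrArg Subtype.val hw
      simp [single, this]
    · have : (κ, x) ≠ (w.1 : Bond d) := fun e => hw (Subtype.ext e)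
      simp [single, hw, this]
  · have : (κ, x) ≠ (w.1 : Bond d) := fun e => h (e ▸ w.1.2)
    simp [single, this]

/-- [folklore] **`θ_w ∘ (1→2 form) = single w₂ (E 1 2)`**. -/
theorem theta_rec12 (w : SB d L × SB d L × SB d L) :
    (fun κ x => theta w (rec12 d L κ x)) = single (w.2.1 : Bond d) (E 1 2) := by
  funext κ x
  unfold rec12
  split_ifs with h
  · rw [theta_m12]
    by_cases hw : (⟨(κ, x), h⟩ : SB d L) = w.2.1
    · have : (κ, x) = (w.2.1 : Bond d) := congrArg Subtype.val hw
      simp [single, this]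
    · have : (κ, x) ≠ (w.2.1 : Bond d) := fun e => hw (Subtype.ext e)
      simp [single, hw, this]
  · have : (κ, x) ≠ (w.2.1 : Bond d) := fun e => h (e ▸ w.2.1.2)
    simp [single, this]

/-- [folklore] **`θ_w ∘ (2→3 form) = single w₃ (E 2 3)`**. -/
theorem theta_rec23 (w : SB d L × SB d L × SB d L) :
    (fun κ x => theta w (rec23 d L κ x)) = single (w.2.2 : Bond d) (E 2 3) := by
  funext κ x
  unfold rec23
  split_ifs with h
  · rw [theta_m23]
    by_cases hw : (⟨(κ, x), h⟩ : SB d L) = w.2.2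
    · have : (κ, x) = (w.2.2 : Bond d) := congrArg Subtype.val hw
      simp [single, this]
    · have : (κ, x) ≠ (w.2.2 : Bond d) := fun e => hw (Subtype.ext e)
      simp [single, hw, this]
  · have : (κ, x) ≠ (w.2.2 : Bond d) := fun e => h (e ▸ w.2.2.2)
    simp [single, this]

end Lattice

end Summit.QuantumFields.BalabanUV.Beta.D1BFx.WordRecordingAlgebra

end
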